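import Literature.IUT.LogThetaLattice.LatticeGlueKummerCompatOfKits
import Literature.IUT.LogThetaLattice.BiCoresRealifiedKummerNaturality
import Literature.IUT.LogThetaLattice.LatticeGlueKummerCompatWitness
import HarnessLib

/-!
# [IUTchIII] Prop 2.1 (vi) / Thm 1.5 (v): the Kummer-coherence PREDICATE on the glue (successor of GAP rows G-w4d026-1 / G-w4d026-2)

Mochizuki, *Inter-universal Teichmüller Theory III*, kurims manuscript (May 2020), §1 Thm 1.5 (iii) p.50, (v) pp.50–51; §2
Prop 2.1 (vi) pp.60–61, Cor 2.3 (iii)(iv) p.75; *II* (Dec 2020) Cor 4.6 (ii) p.133, Cor 4.10 (iv) p.160.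
[claim: Mochizuki2012, status: disputed] (D-0012 claim key). OWNER'S SUCCESSOR of the abc-iut cell GAP-LEDGER rows
**G-w4d026-1** (functoriality of the `ℝ_{>0}`-orbit of realified Kummer isomorphisms, `BiCoricData.realifiedKummer`) and
**G-w4d026-2** (Prop 2.1 (vi) "compatible with the Kummer isomorphisms of (ii) above and Theorem 1.5, (iii)") — the two printed
coherences the landed interfaces `BiCoricData` (`BiCores.lean`) / `LatticeGlue` (`LatticeGlue.lean`) do not carry (abc-iut-w4-d022's
`LatticeGlueKummerCompatWitness.lean`: the square is INDEPENDENT of the interface laws). Per the frozen-file policy the landed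
structures are not edited: the two laws are ONE PREDICATE `LatticeGlue.KummerCoherent G` on a glue (a `Prop`-valued structure, two
fields), so that every consumer keeps `G : LatticeGlue S` and takes `(hG : G.KummerCoherent)` BY NAME.

* `LatticeGlue.KummerCoherent` — fields `kummerSquare` (Prop 2.1 (vi) as ONE equation of natural isomorphisms
  `unitPortion ≪≫ pilotEnvFxm_iso = kummerT ≪≫ associator ≪≫ (htToD ◁ envNat)`, `LatticeGlueKummerCompatOfKits.lean`) and
  `realifiedKummer_map` (Thm 1.5 (v) / Cor 4.6 (ii), the literal shape of G-w4d026-1, `BiCoresRealifiedKummerNaturality.lean`);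
* accessors: the pointwise square (`KummerCoherent.prop21vi_kummerSquare`), the Cor 2.3 (iii) square (`….cor23iii_kummerSquareE`),
  the Cor 2.3 (iv) functoriality of `realifiedTransport` (`….realifiedTransport_conj`);
* producers: `Witness.twoGlue_kummerCoherent` (this seat's witness glue: consistent), `Witness.twoGlueNeg_not_kummerCoherent`
  (w4-d022's variant: the predicate is NOT vacuous — it fails there), `KitsToy.latticeGlue_kummerCoherent` (the toy kit stack),
  and AT THE REAL FRAME `LatticeGlue.ofKits_kummerCoherent_iff` — coherence of `LatticeGlue.ofKits … Gk` ⟺ the two KIT-LEVEL laws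
  on `Gk` (inputs BY NAME for the genuine kit; owners abc-iut-L6-t2 / abc-iut-L5).

Honest framing: a predicate on OUR typed interfaces and its decision at the landed producers; no side taken on
[IUTchIII] Cor 3.12; typed ≠ proved.
-/

namespace Literature.IUT.LogThetaLattice

open CategoryTheory
open Literature.IUT.HodgeTheaters Literature.IUT.HodgeTheaters.PMBaseKit
open AsSmallTransport

universe u

namespace LatticeGlue

variable {S : StripFrame.{u}}

/-- **IUTchIII:Prop2.1(vi)** (kurims p.61) **The Kummer-coherence predicate on a glue** (successor of GAP rows G-w4d026-1 / G-w4d026-2): (1) Prop 2.1 (vi)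
"natural isomorphisms `†F^{⊢×}_△ ⥲ †F^{⊢×}_{env}`, `F^{⊢×}_△(†D^⊢_△) ⥲ F^{⊢×}_{env}(†D_>)` … compatible with the Kummer isomorphisms of (ii)
above and Theorem 1.5, (iii)" — as ONE equation of natural isomorphisms of functors `S.HT ⥤ S.Fxm`; (2) Thm 1.5 (v) p.51 /
[IUTchII] Cor 4.6 (ii) p.133 "functorial algorithm … `ℝ_{>0}`-orbits of isomorphisms" — the orbit `realifiedKummer` is stable
under transport along isomorphisms of Hodge theaters. [claim: Mochizuki2012, status: disputed] -/
@[mk_iff]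
structure KummerCoherent (G : LatticeGlue S) : Prop where
  /-- Prop 2.1 (vi): the Kummer square, `unitPortion ≪≫ pilotEnvFxm_iso = kummerT ≪≫ associator ≪≫ (htToD ◁ envNat)` -/
  kummerSquare :
    G.linkData.unitPortion LatticeKind.nonGaussian ≪≫ G.pilotEnvFxm_iso =
      G.kummerT ≪≫ Functor.associator S.htToD G.biCoric.dvDelta G.biCoric.fxmOfDv ≪≫
        Functor.isoWhiskerLeft S.htToD G.envNat
  /-- Thm 1.5 (v) / [IUTchII] Cor 4.6 (ii): transport along `ξ : X ≅ Y` carries the `ℝ_{>0}`-orbit at `X` into the orbit at `Y` -/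
  realifiedKummer_map : ∀ {X Y : S.HT} (ξ : X ≅ Y)
    (e : G.biCoric.realifiedHT.obj X ≅ G.biCoric.realified.obj (G.biCoric.dvDelta.obj (S.htToD.obj X))),
    e ∈ G.biCoric.realifiedKummer X →
      (G.biCoric.realifiedHT.mapIso ξ).symm ≪≫ e ≪≫
          G.biCoric.realified.mapIso (G.biCoric.dvDelta.mapIso (S.htToD.mapIso ξ)) ∈
        G.biCoric.realifiedKummer Y

namespace KummerCoherent

variable {G : LatticeGlue S} (hG : G.KummerCoherent)
include hG

/-- **IUTchIII:Prop2.1(vi)** (kurims p.61) a coherent glue satisfies the Prop 2.1 (vi) Kummer square at every Hodge theater (abc-iut-w4-d022's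
top route = bottom route). [claim: Mochizuki2012, status: disputed] -/
theorem prop21vi_kummerSquare (X : S.HT) :
    (G.linkData.unitPortion LatticeKind.nonGaussian).app X ≪≫ G.pilotEnvFxm_iso.app X =
      G.kummerT.app X ≪≫ G.envNat.app (S.htToD.obj X) :=
  G.prop21vi_kummerSquare_forall_iff_natIso.mpr hG.kummerSquare X

/-- **IUTchIII:Cor2.3(iii)** (kurims p.75) a coherent glue satisfies the Cor 2.3 (iii) square on `RadialData`'s copies: the comparison
`envNatE : F^{⊢×μ}_△(†D^⊢_△) ⥲ F^{⊢×μ}_{env}(†D_>)` is "compatible with the Kummer isomorphisms of Prop 2.1 (ii) and Thm 1.5 (iii)".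
[claim: Mochizuki2012, status: disputed] -/
theorem cor23iii_kummerSquareE (X : S.HT) :
    ((G.linkData.unitPortion LatticeKind.nonGaussian).app X ≪≫ G.pilotEnvFxm_iso.app X) ≪≫
        (G.fxmEnv_iso.app (S.htToD.obj X)).symm =
      (G.kummerT.app X ≪≫ (G.fxmDeltaE_iso.app (S.htToD.obj X)).symm) ≪≫ G.envNatE.app (S.htToD.obj X) :=
  G.cor23iii_kummerSquareE_of_kummerSquare X (hG.prop21vi_kummerSquare X)

/-- **IUTchIII:Cor2.3(iv)** (kurims p.75) for a coherent glue the Thm 1.5 (v) transported poly-isomorphism of Frobenius-like realified data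
`(^XC^⊩_△, …) ⥲ (^YC^⊩_△, …)` is functorial in arbitrary isomorphisms of Hodge theaters at both ends ("stabilized/equivariant/functorial
with respect to arbitrary automorphisms"). [claim: Mochizuki2012, status: disputed] -/
theorem realifiedTransport_conj {X X' Y Y' : S.HT} (α : X ≅ X') (β : Y ≅ Y') :
    ((PolyIso.single (G.biCoric.realifiedHT.mapIso α).symm).comp (G.biCoric.realifiedTransport X Y)).comp
        (PolyIso.single (G.biCoric.realifiedHT.mapIso β)) =
      G.biCoric.realifiedTransport X' Y' :=
  G.biCoric.realifiedTransport_conj hG.realifiedKummer_map α β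

end KummerCoherent

end LatticeGlue

/-! ### Producers: the witness glues, the toy kit stack, the real frame -/

/-- **IUTchIII:Prop2.1(vi)** (kurims p.61) this seat's witness glue `Witness.twoGlue` (all identifications identities, all orbits full) IS
Kummer-coherent — the predicate is consistent with every interface law. [claim: Mochizuki2012, status: disputed] -/
theorem Witness.twoGlue_kummerCoherent : twoGlue.KummerCoherent where
  kummerSquare := twoGlue.prop21vi_kummerSquare_forall_iff_natIso.mp twoGlue_prop21vi_kummerSquare
  realifiedKummer_map ξ e he := twoBiCoric.realifiedKummer_map_of_full (fun _ => rfl) ξ e he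

/-- **IUTchIII:Prop2.1(vi)** (kurims p.61) abc-iut-w4-d022's variant glue `Witness.twoGlueNeg` (unit portion `−1`) is NOT Kummer-coherent —
the predicate is not vacuous: it is exactly what separates `twoGlue` from `twoGlueNeg`. [claim: Mochizuki2012, status: disputed] -/
theorem Witness.twoGlueNeg_not_kummerCoherent : ¬ twoGlueNeg.KummerCoherent := fun h =>
  twoGlueNeg_prop21vi_kummerSquare_fails ⟨(0, 0)⟩ (h.prop21vi_kummerSquare ⟨(0, 0)⟩)

namespace KitsToy

variable (l : ℕ) [Fact l.Prime] (hl : l ≠ 2)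

/-- **IUTchIII:Prop2.1(vi)** (kurims p.61) the toy glue `KitsToy.latticeGlue` (the glued §1–§2 data assembled by `LatticeGlue.ofKits` over
abc-iut-L5-t4's toy kits) IS Kummer-coherent (`LatticeGlueKummerCompatOfKits` §3, `BiCoresRealifiedKummerNaturality` §3).
Toy-class witness. [claim: Mochizuki2012, status: disputed] -/
theorem latticeGlue_kummerCoherent : (latticeGlue l hl).KummerCoherent where
  kummerSquare :=
    (latticeGlue l hl).prop21vi_kummerSquare_forall_iff_natIso.mp (latticeGlue_prop21vi_kummerSquare l hl)
  realifiedKummer_map ξ e he := latticeGlue_realifiedKummer_map l hl ξ e he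

end KitsToy

section Kit

variable {l : ℕ} {K : PMBaseKit.{u} l} {M : K.MultKit} {FK : K.FKit M}
  (L : FK.MonoLaws) (hbij : FK.IsomFtoDBijective) (hsurj : FK.IsomFmtoDmSurjective) (hR : FK.RlfOfIsStrip)
  (X : TimesMuSide FK L)
  (h : ∀ A B : X.Fglxm, Function.Surjective (fun g : A ≅ B => (X.FglxmToFvtxm ⋙ X.FvtxmToFxm).mapIso g))
  (Gk : LatticeGlueKit hR X)

/-- **IUTchIII:Prop2.1(vi)** (kurims p.61) **AT THE REAL FRAME**: the glued data `LatticeGlue.ofKits … Gk` over `StripFrame.ofKits L hbij hsurj hR X` is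
Kummer-coherent IF AND ONLY IF the kit-level data satisfy the two KIT-LEVEL laws — (1) the Prop 2.1 (vi) square on the
identifications of `Gk` at ONE representative-level Hodge theater `H₀` (one suffices under [IUTchI] Cor 5.3 (ii)), (2) the transport
law on the kit-level `ℝ_{>0}`-orbit `Gk.biCoricKit.realifiedKummer` — inputs BY NAME for the genuine kit (owners abc-iut-L6-t2 /
abc-iut-L5); nothing on the [IUTchIII] side. [claim: Mochizuki2012, status: disputed] -/
theorem LatticeGlue.ofKits_kummerCoherent_iff (H₀ : HTRep FK) :
    (LatticeGlue.ofKits L hbij hsurj hR X h Gk).KummerCoherent ↔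
      ((Gk.linkKit.unitPortion LatticeKind.nonGaussian).app H₀ ≪≫
            (X.FglxmToFvtxm ⋙ X.FvtxmToFxm).mapIso (Gk.pilotEnv_iso.app H₀) ≪≫
              (X.FglxmToFvtxm ⋙ X.FvtxmToFxm).mapIso (X.FglToFglxm.mapIso (Gk.thetaMonoidKit.kummerFgl.app H₀)) =
          ((Gk.fxmDeltaHT_iso.app H₀).symm ≪≫ Gk.biCoricKit.kummer.app H₀) ≪≫
            ((Gk.fxmDeltaD_iso.app (HTRep.toDFunctor.obj H₀)).symm ≪≫
              Gk.thetaMonoidKit.unitPortionD.app (HTRep.toDFunctor.obj H₀))) ∧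
        ∀ {H H' : HTRep FK} (ξ : H ≅ H')
          (e : Gk.biCoricKit.realifiedHT.obj H ≅
            Gk.biCoricKit.realified.obj (Gk.biCoricKit.dvDelta.obj (HTRep.toDFunctor.obj H))),
          e ∈ Gk.biCoricKit.realifiedKummer H →
            (Gk.biCoricKit.realifiedHT.mapIso ξ).symm ≪≫ e ≪≫
                Gk.biCoricKit.realified.mapIso (Gk.biCoricKit.dvDelta.mapIso (HTRep.toDFunctor.mapIso ξ)) ∈
              Gk.biCoricKit.realifiedKummer H' := by
  constructor
  · intro hG
    refine ⟨(LatticeGlue.ofKits_prop21vi_kummerSquare_iff L hbij hsurj hR X h Gk (AsSmall.up.obj H₀)).mp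
        (hG.prop21vi_kummerSquare _), ?_⟩
    exact (BiCoricData.ofKits_realifiedKummer_map_iff L hbij hsurj hR X Gk.biCoricKit).mp hG.realifiedKummer_map
  · rintro ⟨h₁, h₂⟩
    exact
      { kummerSquare := (LatticeGlue.ofKits L hbij hsurj hR X h Gk).prop21vi_kummerSquare_forall_iff_natIso.mp
          (LatticeGlue.ofKits_prop21vi_kummerSquare_forall_of_one L hbij hsurj hR X h Gk H₀ h₁)
        realifiedKummer_map :=
          (BiCoricData.ofKits_realifiedKummer_map_iff L hbij hsurj hR X Gk.biCoricKit).mpr h₂ }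

end Kit

end Literature.IUT.LogThetaLattice
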